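import Summits.QuantumFields.YangMills.Theorems.ColdStartUniversalityLatticeLangevinTimeAverageHoeffdingCorrector
import HarnessLib

/-!
# Route `ColdStartUniversality` (fixed-cut-off SZZ dynamics): THE MARTINGALE INCREMENTS OF THE POISSON CORRECTOR ALONG A STRONG SOLUTION —
# adapted, bounded by `2β_u + 2h`, ORTHOGONAL TO THE PAST `𝓕^W_(kh)`, telescoping to `u(U_(nh)) − u(x) + ∫_(0,nh] Ĝ(U_r) dr`

Helper file (seat `ym-line-csu-p1`, g34; `--supports stmt-QuantumFields-24809`).  Files 70/73 built, inside their proofs, the increments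
`D_k = u(U_((k+1)h)) − u(U_(kh)) + ∫_(kh,(k+1)h] Ĝ(U_r) dr` of the Poisson/Dynkin martingale (`Ĝ = G − μ_(β')G`, `u` a bounded measurable mild
corrector: `κ_s u − u = −∫₀ˢ κ_r Ĝ dr`) and used their orthogonality only against the exponential weights `e^(λS_k)`.  This file exports the
construction once, with the full ORTHOGONALITY TO THE PAST needed by the maximal inequality of file 78:
* ★★★ `exists_correctorIncrements` — for every realising kernel family `κ`, continuous `|G| ≤ 1`, bounded measurable corrector `u` (`|u| ≤ β_u`),
  every strong solution `U` from a deterministic start `x` on ANY space whose restrictions to `[0,i] × Ω` are `𝓑([0,i]) ⊗ 𝓕^W_i`-measurable, and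
  every step `h > 0`, there are `D_k : Ω → ℝ` with (i) `D_k` `𝓕^W_((k+1)h)`-measurable, (ii) `|D_k| ≤ 2β_u + 2h`, (iii) `∫ Z·D_k dP = 0` for every
  bounded non-negative `𝓕^W_(kh)`-measurable `Z`, (iv) `Σ_(k<n) D_k = u(U_(nh)) − u(x) + ∫_(0,nh] Ĝ(U_r) dr` for every `n`
  (Markov property file 44, time-integrated Markov property file 69, adaptedness of path integrals `measurable_setIntegral_path`).
THEOREMS ONLY, no definition, no sorry; [folklore].  HONEST FRAMING: fixed cut-off; `UniformColdStartMixing` (24809) is NOT restated; no crux, rung or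
summit statement is proved; the Yang–Mills mass gap is NOT proved.
-/

set_option autoImplicit false

noncomputable section

namespace Summit.QuantumFields.YangMills.Theorems.ColdStartUniversality

open MeasureTheory ProbabilityTheory Filter Topology Set
open scoped NNReal ENNReal BigOperators
open Literature Literature.Probability.Process Literature.MathematicalPhysics.QuantumFieldTheory
open Literature.MathematicalPhysics.QuantumLattice (fundamentalRep fundamentalLatticeRep continuous_fundamentalRep)

variable {L : ℕ} [NeZero L]

/-- ★★★ **The martingale increments of the Poisson corrector along a progressively measurable strong solution.**  See the module docstring:
adapted, bounded by `2β_u + 2h`, orthogonal to every bounded non-negative `𝓕^W_(kh)`-measurable weight, and telescoping to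
`u(U_(nh)) − u(x) + ∫_(0,nh] (G − μ_(β')G)(U_r) dr`. [folklore] -/
theorem exists_correctorIncrements (β' : ℝ)
    (κ : ℝ≥0 → Kernel (GaugeConfig 3 L (Matrix.specialUnitaryGroup (Fin 2) ℂ))
      (GaugeConfig 3 L (Matrix.specialUnitaryGroup (Fin 2) ℂ))) [∀ t, IsMarkovKernel (κ t)]
    (hreal : ∀ (t : ℝ≥0) (x : GaugeConfig 3 L (Matrix.specialUnitaryGroup (Fin 2) ℂ))
        (Ω : Type) [MeasurableSpace Ω] (P : Measure Ω) [IsProbabilityMeasure P]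
        (W : ℝ≥0 → Ω → (Edge 3 L × NoiseIdx 2 → ℝ)) (hW : IsFlatBrownian W P)
        (U : ℝ≥0 → Ω → GaugeConfig 3 L (Matrix.specialUnitaryGroup (Fin 2) ℂ)),
        (∀ ω, U 0 ω = x) →
        (latticeLangevinDynamics (fundamentalLatticeRep 2) β').IsSolution (fundamentalRep (Fin 2))
          hW.natFiltration P W U →
        κ t x = P.map (U t))
    {G : GaugeConfig 3 L (Matrix.specialUnitaryGroup (Fin 2) ℂ) → ℝ} (hG : Continuous G) (hG1 : ∀ z, |G z| ≤ 1)
    {u : GaugeConfig 3 L (Matrix.specialUnitaryGroup (Fin 2) ℂ) → ℝ} (hum : Measurable u) {βu : ℝ} (hu_b : ∀ y, |u y| ≤ βu)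
    (hPois : ∀ (s : ℝ≥0) (y : GaugeConfig 3 L (Matrix.specialUnitaryGroup (Fin 2) ℂ)),
      (∫ z, u z ∂(κ s y)) - u y = -∫ t in (0 : ℝ)..(s : ℝ),
        (∫ z, (G z - ∫ z', G z' ∂(wilsonMeasure (d := 3) (L := L) (fundamentalRep (Fin 2)) β')) ∂(κ t.toNNReal y)))
    (x : GaugeConfig 3 L (Matrix.specialUnitaryGroup (Fin 2) ℂ))
    {Ω : Type} [MeasurableSpace Ω] {P : Measure Ω} [IsProbabilityMeasure P]
    {W : ℝ≥0 → Ω → (Edge 3 L × NoiseIdx 2 → ℝ)} (hW : IsFlatBrownian W P)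
    {U : ℝ≥0 → Ω → GaugeConfig 3 L (Matrix.specialUnitaryGroup (Fin 2) ℂ)} (hU0 : ∀ ω, U 0 ω = x)
    (hU : (latticeLangevinDynamics (fundamentalLatticeRep 2) β').IsSolution (fundamentalRep (Fin 2)) hW.natFiltration P W U)
    (hprog : ∀ i : ℝ≥0, Measurable[@Prod.instMeasurableSpace (Set.Iic i) Ω inferInstance (hW.natFiltration i)]
      (fun q : Set.Iic i × Ω => U q.1 q.2))
    {h : ℝ} (hh0 : 0 < h) :
    ∃ D : ℕ → Ω → ℝ,
      (∀ k, Measurable[hW.natFiltration (((k + 1 : ℕ) : ℝ) * h).toNNReal] (D k)) ∧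
      (∀ k ω, |D k ω| ≤ 2 * βu + 2 * h) ∧
      (∀ (k : ℕ) (Z : Ω → ℝ), Measurable[hW.natFiltration ((k : ℝ) * h).toNNReal] Z → (∀ ω, 0 ≤ Z ω) → (∃ CZ : ℝ, ∀ ω, Z ω ≤ CZ) →
        ∫ ω, Z ω * D k ω ∂P = 0) ∧
      (∀ (n : ℕ) ω, ∑ k ∈ Finset.range n, D k ω = u (U (((n : ℝ) * h).toNNReal) ω) - u x +
        ∫ r in Ioc (0 : ℝ) (n * h), (G (U r.toNNReal ω) - ∫ z', G z' ∂(wilsonMeasure (d := 3) (L := L) (fundamentalRep (Fin 2)) β'))) := by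
  classical
  haveI := secondCountableTopology_su2
  haveI := borelSpace_config L
  haveI : IsProbabilityMeasure (wilsonMeasure (d := 3) (L := L) (fundamentalRep (Fin 2)) β') :=
    isProbabilityMeasure_wilsonMeasure (d := 3) (L := L) (fundamentalRep (Fin 2)) (continuous_fundamentalRep (Fin 2)) β'
  set m : ℝ := ∫ z', G z' ∂(wilsonMeasure (d := 3) (L := L) (fundamentalRep (Fin 2)) β') with hm
  have hGm : Measurable G := hG.measurable
  have hm1 : |m| ≤ 1 := by
    have hh := norm_integral_le_of_norm_le_const (μ := wilsonMeasure (d := 3) (L := L) (fundamentalRep (Fin 2)) β') (f := G) (C := 1)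
      (Eventually.of_forall fun z => by simpa [Real.norm_eq_abs] using hG1 z)
    simpa [Real.norm_eq_abs] using hh
  set Gh : GaugeConfig 3 L (Matrix.specialUnitaryGroup (Fin 2) ℂ) → ℝ := fun z => G z - m with hGh
  have hGhc : Continuous Gh := hG.sub continuous_const
  have hGhm : Measurable Gh := hGhc.measurable
  have hGhb : ∀ z, |Gh z| ≤ 2 := fun z => (abs_sub _ _).trans (by linarith [hG1 z, hm1])
  -- the grid `t_k = k h`
  set t : ℕ → ℝ := fun k => (k : ℝ) * h with ht
  have ht0 : ∀ k, 0 ≤ t k := fun k => by positivity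
  have htsucc : ∀ k, t (k + 1) = t k + h := fun k => by simp only [ht]; push_cast; ring
  have htmono : ∀ k, t k ≤ t (k + 1) := fun k => by rw [htsucc]; linarith
  have htNN : ∀ k, (t (k + 1)).toNNReal = (t k).toNNReal + h.toNNReal := fun k => by
    rw [htsucc, Real.toNNReal_add (ht0 k) hh0.le]
  -- measurability
  have hJ : Measurable fun q : Ω × ℝ => U q.2.toNNReal q.1 :=
    measurable_uncurry_of_prog (Z := U) (fun n : ℕ => hW.natFiltration n) (fun n => hW.natFiltration.le n) (fun n => hprog n)
  have hmU : ∀ s : ℝ≥0, Measurable (U s) := fun s => (hU.adapted s).mono (hW.natFiltration.le s) le_rfl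
  have hsec : ∀ ω, Measurable fun r : ℝ => U r.toNNReal ω := fun ω => hJ.comp (measurable_const.prodMk measurable_id)
  have hii : ∀ ω (a a' : ℝ), IntervalIntegrable (fun r => Gh (U r.toNNReal ω)) volume a a' := fun ω a a' =>
    (intervalIntegrable_const (c := (2 : ℝ))).mono_fun' ((hGhm.comp (hsec ω)).aestronglyMeasurable)
      (ae_of_all _ fun r => by simp only [Real.norm_eq_abs]; exact hGhb _)
  -- the increments
  set D : ℕ → Ω → ℝ := fun k ω =>
    u (U (t (k + 1)).toNNReal ω) - u (U (t k).toNNReal ω) + ∫ r in Ioc (t k) (t (k + 1)), Gh (U r.toNNReal ω) with hD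
  have hIF : ∀ k, Measurable[hW.natFiltration (t (k + 1)).toNNReal] fun ω => ∫ r in Ioc (t k) (t (k + 1)), Gh (U r.toNNReal ω) :=
    fun k => measurable_setIntegral_path (mΩ := hW.natFiltration (t (k + 1)).toNNReal) (t (k + 1)).toNNReal (hprog _) hGhm (ht0 k)
      (by rw [Real.coe_toNNReal _ (ht0 (k + 1))])
  have hIm : ∀ k, Measurable fun ω => ∫ r in Ioc (t k) (t (k + 1)), Gh (U r.toNNReal ω) :=
    fun k => (hIF k).mono (hW.natFiltration.le _) le_rfl
  have hDF : ∀ k, Measurable[hW.natFiltration (t (k + 1)).toNNReal] (D k) := by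
    intro k
    have h1 : Measurable[hW.natFiltration (t (k + 1)).toNNReal] fun ω => u (U (t (k + 1)).toNNReal ω) := hum.comp (hU.adapted _)
    have h2 : Measurable[hW.natFiltration (t (k + 1)).toNNReal] fun ω => u (U (t k).toNNReal ω) :=
      (hum.comp (hU.adapted _)).mono (hW.natFiltration.mono (Real.toNNReal_le_toNNReal (htmono k))) le_rfl
    exact (h1.sub h2).add (hIF k)
  -- boundedness
  have hub : ∀ y y', |u y - u y'| ≤ 2 * βu := fun y y' =>
    (abs_sub _ _).trans (by linarith [hu_b y, hu_b y'])
  have hIb : ∀ k ω, |∫ r in Ioc (t k) (t (k + 1)), Gh (U r.toNNReal ω)| ≤ 2 * h := fun k ω => by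
    have hh' := norm_setIntegral_le_of_norm_le_const (μ := volume) (s := Ioc (t k) (t (k + 1))) measure_Ioc_lt_top
      (fun r _ => show ‖Gh (U r.toNNReal ω)‖ ≤ 2 by rw [Real.norm_eq_abs]; exact hGhb _) (f := fun r => Gh (U r.toNNReal ω))
    have hvol : volume.real (Ioc (t k) (t (k + 1))) = h := by rw [Real.volume_real_Ioc_of_le (htmono k), htsucc]; ring
    rw [Real.norm_eq_abs, hvol] at hh'
    exact hh'
  have hDb : ∀ k ω, |D k ω| ≤ 2 * βu + 2 * h := fun k ω => by
    simp only [hD]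
    exact (abs_add_le _ _).trans (add_le_add (hub _ _) (hIb k ω))
  -- orthogonality to the past
  have horth : ∀ (k : ℕ) (Z : Ω → ℝ), Measurable[hW.natFiltration (t k).toNNReal] Z → (∀ ω, 0 ≤ Z ω) → (∃ CZ : ℝ, ∀ ω, Z ω ≤ CZ) →
      ∫ ω, Z ω * D k ω ∂P = 0 := by
    intro k Z hZF hZ0 hZbd
    obtain ⟨CZ, hZCZ⟩ := hZbd
    have hZm : Measurable Z := hZF.mono (hW.natFiltration.le _) le_rfl
    have hZb : ∀ ω, |Z ω| ≤ CZ := fun ω => by rw [abs_of_nonneg (hZ0 ω)]; exact hZCZ ω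
    have e1 : ∫ ω, Z ω * u (U (t (k + 1)).toNNReal ω) ∂P =
        ∫ ω, Z ω * (∫ z, u z ∂(κ h.toNNReal (U (t k).toNNReal ω))) ∂P := by
      rw [htNN k]
      exact integral_mul_comp_add_eq_integral_mul_transition β' κ hreal x hW hU0 hU (t k).toNNReal h.toNNReal hZF hZb hum hu_b
    have e2 : ∫ ω, Z ω * (∫ r in Ioc (t k) (t (k + 1)), Gh (U r.toNNReal ω)) ∂P =
        ∫ ω, Z ω * (∫ v in Ioc (0 : ℝ) h, ∫ z, Gh z ∂(κ v.toNNReal (U (t k).toNNReal ω))) ∂P := by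
      have hIoc : Ioc (t k) (t (k + 1)) = Ioc (((t k).toNNReal : ℝ≥0) : ℝ) (((t k).toNNReal : ℝ≥0) + h) := by
        rw [Real.coe_toNNReal _ (ht0 k), htsucc]
      rw [hIoc]
      exact integral_mul_setIntegral_comp_eq_integral_mul_setIntegral_transition β' κ hreal x hW hU0 hU hJ (t k).toNNReal hh0.le
        hZF hZb hGhc hGhb
    have e3 : ∀ y, (∫ v in Ioc (0 : ℝ) h, ∫ z, Gh z ∂(κ v.toNNReal y)) = u y - ∫ z, u z ∂(κ h.toNNReal y) := fun y => by
      have hp := hPois h.toNNReal y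
      rw [Real.coe_toNNReal _ hh0.le] at hp
      rw [← intervalIntegral.integral_of_le hh0.le]
      linarith
    have hκub : ∀ y, |∫ z, u z ∂(κ h.toNNReal y)| ≤ βu := fun y => by
      have hh' := norm_integral_le_of_norm_le_const (μ := κ h.toNNReal y) (f := u) (C := βu)
        (Eventually.of_forall fun z => by simpa [Real.norm_eq_abs] using hu_b z)
      simpa [Real.norm_eq_abs] using hh'
    have hκum : Measurable fun y => ∫ z, u z ∂(κ h.toNNReal y) := (hum.stronglyMeasurable.integral_kernel (κ := κ h.toNNReal)).measurable
    have hInt : ∀ {φ : Ω → ℝ} {Cφ : ℝ}, Measurable φ → (∀ ω, |φ ω| ≤ Cφ) → Integrable (fun ω => Z ω * φ ω) P :=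
      fun {φ Cφ} hφ hφb => (integrable_const (CZ * Cφ)).mono' (hZm.mul hφ).aestronglyMeasurable
        (Eventually.of_forall fun ω => by
          rw [norm_mul, Real.norm_eq_abs, Real.norm_eq_abs]
          exact mul_le_mul (hZb ω) (hφb ω) (abs_nonneg _) ((abs_nonneg _).trans (hZb ω)))
    have i1 : Integrable (fun ω => Z ω * u (U (t (k + 1)).toNNReal ω)) P := hInt (hum.comp (hmU _)) fun ω => hu_b _
    have i2 : Integrable (fun ω => Z ω * u (U (t k).toNNReal ω)) P := hInt (hum.comp (hmU _)) fun ω => hu_b _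
    have i3 : Integrable (fun ω => Z ω * ∫ r in Ioc (t k) (t (k + 1)), Gh (U r.toNNReal ω)) P := hInt (hIm k) (hIb k)
    have i4 : Integrable (fun ω => Z ω * ∫ z, u z ∂(κ h.toNNReal (U (t k).toNNReal ω))) P := hInt (hκum.comp (hmU _)) fun ω => hκub _
    have hsplit : ∫ ω, Z ω * D k ω ∂P = (∫ ω, Z ω * u (U (t (k + 1)).toNNReal ω) ∂P) - (∫ ω, Z ω * u (U (t k).toNNReal ω) ∂P) +
        ∫ ω, Z ω * (∫ r in Ioc (t k) (t (k + 1)), Gh (U r.toNNReal ω)) ∂P := by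
      have hpt : ∀ ω, Z ω * D k ω = (Z ω * u (U (t (k + 1)).toNNReal ω) - Z ω * u (U (t k).toNNReal ω)) +
          Z ω * (∫ r in Ioc (t k) (t (k + 1)), Gh (U r.toNNReal ω)) := fun ω => by simp only [hD]; ring
      rw [integral_congr_ae (ae_of_all _ hpt),
        integral_add (f := fun ω => Z ω * u (U (t (k + 1)).toNNReal ω) - Z ω * u (U (t k).toNNReal ω)) (i1.sub i2) i3,
        integral_sub i1 i2]
    have e23 : ∫ ω, Z ω * (∫ v in Ioc (0 : ℝ) h, ∫ z, Gh z ∂(κ v.toNNReal (U (t k).toNNReal ω))) ∂P =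
        (∫ ω, Z ω * u (U (t k).toNNReal ω) ∂P) - ∫ ω, Z ω * (∫ z, u z ∂(κ h.toNNReal (U (t k).toNNReal ω))) ∂P := by
      rw [← integral_sub i2 i4]
      exact integral_congr_ae (ae_of_all _ fun ω => by dsimp only; rw [e3, mul_sub])
    rw [hsplit, e1, e2, e23]
    ring
  -- telescoping
  have hsum : ∀ (n : ℕ) ω, ∑ j ∈ Finset.range n, D j ω =
      u (U (t n).toNNReal ω) - u x + ∫ r in Ioc (0 : ℝ) (t n), Gh (U r.toNNReal ω) := by
    intro n ω
    have h1 : ∑ j ∈ Finset.range n, D j ω = ∑ j ∈ Finset.range n, (u (U (t (j + 1)).toNNReal ω) - u (U (t j).toNNReal ω)) +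
        ∑ j ∈ Finset.range n, ∫ r in Ioc (t j) (t (j + 1)), Gh (U r.toNNReal ω) := by
      rw [← Finset.sum_add_distrib]
    have h2 : ∑ j ∈ Finset.range n, ∫ r in Ioc (t j) (t (j + 1)), Gh (U r.toNNReal ω) = ∫ r in Ioc 0 (t n), Gh (U r.toNNReal ω) := by
      have h3 : ∑ j ∈ Finset.range n, ∫ r in (t j)..(t (j + 1)), Gh (U r.toNNReal ω) = ∫ r in (t 0)..(t n), Gh (U r.toNNReal ω) :=
        intervalIntegral.sum_integral_adjacent_intervals fun j _ => hii ω _ _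
      have ht00 : t 0 = 0 := by simp [ht]
      rw [Finset.sum_congr rfl fun j _ => intervalIntegral.integral_of_le (htmono j), ht00,
        intervalIntegral.integral_of_le (ht0 n)] at h3
      exact h3
    have hu0 : u (U (t 0).toNNReal ω) = u x := by
      have : (t 0).toNNReal = 0 := by simp [ht]
      rw [this, hU0 ω]
    rw [h1, Finset.sum_range_sub (fun j => u (U (t j).toNNReal ω)), h2, hu0]
  refine ⟨D, hDF, hDb, horth, fun n ω => ?_⟩
  rw [hsum n ω]

end Summit.QuantumFields.YangMills.Theorems.ColdStartUniversality

end
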